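import Summits.SmoothPoincare4.SmoothPoincare4.Theorems.DottedCircleRasmussenDcrGapHelperFriendsCarrierVkPartAPartIPicture
import Summits.SmoothPoincare4.SmoothPoincare4.Theorems.DottedCircleRasmussenDcrGapHelperFriendsCarrierVkPartAPartILoops
import Literature.Topology.FourManifolds.SliceDiscZeroFraming

/-!
# Helper `helper_friendsCarrier_Vk_partA_partI` (V_k part A, part I: the tube framing is the Seifert
framing), piece 10: the two inputs about the push-off — zero framing in the picture, zero planar windings
(line `mk_friends`, crux `DcrGap`; item stmt-SmoothPoincare4-16128, route route-SmoothPoincare4-DottedCircleRasmussen)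

* `FriendsCarrierVk.loopClass_radius_longitude_eq_zero` — **a `0`-framed tube has null-homologous push-offs at
  every radius**: for an oriented tubular neighbourhood `ν'` of a knot `J` with `ν'.HasFraming 0`, the loop
  `t ↦ ν'(e^{2πit}, ρ e₀)`, `ρ > 0`, has Hurewicz class `0` in `H₁(S³ ∖ J; ℤ)` (the tree's
  `loopClass_longitude_eq_of_hasFraming` at radius `½`, and the radial free homotopy in the punctured tube);
* `FriendsCarrierVk.loopClass_planarWinding_eq_zero` — **the planar windings of a push-off of a null-homologous
  model knot vanish**: for a tube `νK` of `K₁` in `M_k` and a hole `c_j`, the loop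
  `t ↦ z(νK(e^{2πit}, s e₀)) − c_j` of `ℂ ∖ 0` has Hurewicz class `0` — shrink the radius `s` to `0` inside `M_k`
  (where `z ≠ c_j` by the guard), then use the free null-homotopy of `z ∘ K₁` in `ℂ ∖ {c_j}` which IS
  `MMSW.IsNullHomologous k K₁`;
* `FriendsCarrierVk.pic_knot_eq` — the picture of the model knot is the picture knot: `P(K₁ u) = J u`.

* `helper_friendsCarrier_Vk_partA_partI_winding` — the registered statement.

No definitions, no named facts, no `sorry`.

## References

* D. Rolfsen, *Knots and Links* (1976), §5.D, §9.F (longitudes and framings). [Rolfsen1976]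
* C. Manolescu, M. Marengon, S. Sarkar, M. Willis, Duke Math. J. 172 (2023), §3.1 (null-homologous links in
  `#ʳ S¹ × S²`). [ManolescuMarengonSarkarWillis2023]
-/

set_option linter.dupNamespace false
set_option linter.style.longLine false

noncomputable section

open scoped Manifold ContDiff Topology ComplexConjugate unitInterval
open Function Set Metric TopologicalSpace Literature.Topology.FourManifolds Literature.Topology.FourManifolds.MMSW
  Literature.AlgebraicTopology.Homotopy.HopfFibration Literature.AlgebraicTopology.SingularHomology
  Literature.AlgebraicTopology.FundamentalGroup.PuncturedPlane

namespace Summit.SmoothPoincare4.SmoothPoincare4.Theorems.DcrGap.MkFriends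

namespace FriendsCarrierVk

/-- The base circle point is the first basis vector. [folklore] -/
theorem circlePoint_zero_eq_single :
    ((circlePoint 0 : sphere (0 : EuclideanSpace ℝ (Fin 2)) 1) : EuclideanSpace ℝ (Fin 2)) = EuclideanSpace.single 0 1 := by
  ext i; fin_cases i <;> simp [circlePoint]

/-! ## Zero framing: push-offs of every radius are null-homologous -/

/-- **A `0`-framed tube has null-homologous push-offs at every radius.** [cite: Rolfsen1976, §9.F] -/
theorem loopClass_radius_longitude_eq_zero {J : Knot} (ν' : Knot.TubularNbhd J) (hfr : ν'.HasFraming 0) {ρ : ℝ} (hρ : 0 < ρ)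
    {b : ↥J.complement} (ℓ : Path b b)
    (hℓ : ∀ t, ((ℓ t : ↥J.complement) : sphere (0 : EuclideanSpace ℝ (Fin 4)) 1) =
      ν' (circlePoint (2 * Real.pi * t), ρ • ((circlePoint 0 : sphere (0 : EuclideanSpace ℝ (Fin 2)) 1) : EuclideanSpace ℝ (Fin 2)))) :
    loopClass ℤ ℤ (1 : ℤ) ℓ = 0 := by
  -- radii `(1 - a)/2 + a ρ > 0`
  have hρa : ∀ a : I, (1 - (a : ℝ)) / 2 + a * ρ ≠ 0 := fun a => by
    have h0 : (0 : ℝ) ≤ a := a.2.1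
    have h1 : (a : ℝ) ≤ 1 := a.2.2
    have : 0 < (1 - (a : ℝ)) / 2 + a * ρ := by
      rcases eq_or_lt_of_le h0 with h | h
      · rw [← h]; norm_num
      · nlinarith
    exact this.ne'
  have h0 := loopClass_eq_of_free_family
    (fun q : I × I => (⟨ν' (circlePoint (2 * Real.pi * q.2), (((1 - (q.1 : ℝ)) / 2 + q.1 * ρ) •
        ((circlePoint 0 : sphere (0 : EuclideanSpace ℝ (Fin 2)) 1) : EuclideanSpace ℝ (Fin 2)))),
      ν'.apply_mem_compl_range (smul_ne_zero (hρa q.1) (ne_zero_of_mem_unit_sphere _))⟩ : ↥J.complement))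
    (Continuous.subtype_mk (ν'.continuous.comp (by fun_prop)) _) (fun a => Subtype.ext ?_) ν'.longitude ℓ (fun t => Subtype.ext ?_)
    (fun t => Subtype.ext ?_)
  · rw [← h0, ν'.loopClass_longitude_eq_of_hasFraming hfr, zero_zsmul]
  · show ν' _ = ν' _
    simp only [Set.Icc.coe_zero, Set.Icc.coe_one, mul_zero, mul_one]
    rw [← zero_add (2 * Real.pi), circlePoint_add_two_pi]
  · rw [Knot.TubularNbhd.coe_longitude_apply]
    show ν' _ = ν' _
    simp [framingBaseVector]
  · rw [hℓ t]
    show ν' _ = ν' _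
    simp

/-! ## The picture of the model knot -/

/-- **The picture of the model knot is the picture knot**: `P(K₁ u) = J u` when the tube of `K₁` is drawn onto
the tube of `J`. [folklore] -/
theorem pic_knot_eq {k : ℕ} {K₁ : (sphere (0 : EuclideanSpace ℝ (Fin 2)) 1) → EuclideanSpace ℝ (Fin 4)}
    {νK : (sphere (0 : EuclideanSpace ℝ (Fin 2)) 1) × EuclideanSpace ℝ (Fin 2) → EuclideanSpace ℝ (Fin 4)}
    (hν0 : ∀ u : (sphere (0 : EuclideanSpace ℝ (Fin 2)) 1), νK (u, 0) = K₁ u) {J : Knot} {ν' : Knot.TubularNbhd J} {r : ℝ}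
    (hpic : ∀ (u : (sphere (0 : EuclideanSpace ℝ (Fin 2)) 1)) (w : EuclideanSpace ℝ (Fin 2)), ‖w‖ < 1 →
      toSphereThree (draw k (νK (u, w))).1 (draw k (νK (u, w))).2 = ν' (u, r • w)) (u : (sphere (0 : EuclideanSpace ℝ (Fin 2)) 1)) :
    stereoNorthInv (draw k (K₁ u)) = J u := by
  have := hpic u 0 (by simp)
  rw [smul_zero, ν'.coe_apply_zero, hν0, toSphereThree_eq_stereoNorthInv] at this
  exact this

/-! ## Zero planar windings of the push-off -/

/-- **The planar windings of a push-off of a null-homologous model knot vanish.** [cite: ManolescuMarengonSarkarWillis2023, §3.1] -/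
theorem loopClass_planarWinding_eq_zero {k : ℕ} (K₁ : (sphere (0 : EuclideanSpace ℝ (Fin 2)) 1) → EuclideanSpace ℝ (Fin 4))
    (νK : (sphere (0 : EuclideanSpace ℝ (Fin 2)) 1) × EuclideanSpace ℝ (Fin 2) → EuclideanSpace ℝ (Fin 4))
    (hK : Continuous K₁) (hν : Continuous νK) (hνM : ∀ p, νK p ∈ modelBoundary k)
    (hν0 : ∀ u : (sphere (0 : EuclideanSpace ℝ (Fin 2)) 1), νK (u, 0) = K₁ u) (hN : IsNullHomologous k K₁) (j : Fin k) (s : ℝ)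
    {b : CStar} (ℓ : Path b b)
    (hℓ : ∀ t, ((ℓ t : CStar) : ℂ) = zC (νK (circlePoint (2 * Real.pi * t), s • EuclideanSpace.single 0 1)) - holeCentre k j) :
    loopClass ℤ ℤ (1 : ℤ) ℓ = 0 := by
  have hne : ∀ q : (sphere (0 : EuclideanSpace ℝ (Fin 2)) 1) × EuclideanSpace ℝ (Fin 2), zC (νK q) - holeCentre k j ≠ 0 := fun q =>
    sub_ne_zero.2 (zC_ne_holeCentre (hνM q).1 j)
  -- the loop `z ∘ K₁ - c_j`
  have hK0 : ∀ u, zC (K₁ u) - holeCentre k j ≠ 0 := fun u => by rw [← hν0]; exact hne _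
  let ℓ₂ : Path (⟨zC (K₁ (circlePoint 0)) - holeCentre k j, hK0 _⟩ : CStar) ⟨zC (K₁ (circlePoint 0)) - holeCentre k j, hK0 _⟩ :=
    { toFun := fun t => ⟨zC (K₁ (circlePoint (2 * Real.pi * t))) - holeCentre k j, hK0 _⟩
      continuous_toFun := Continuous.subtype_mk ((continuous_zC.comp (hK.comp (by fun_prop))).sub continuous_const) _
      source' := by apply Subtype.ext; simp
      target' := by
        apply Subtype.ext
        show zC (K₁ (circlePoint (2 * Real.pi * (1 : ℝ)))) - holeCentre k j = _
        rw [mul_one, ← zero_add (2 * Real.pi), circlePoint_add_two_pi] }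
  -- shrinking the radius
  have h1 : loopClass ℤ ℤ (1 : ℤ) ℓ = loopClass ℤ ℤ (1 : ℤ) ℓ₂ := by
    refine loopClass_eq_of_free_family
      (fun q : I × I => (⟨zC (νK (circlePoint (2 * Real.pi * q.2), ((1 - (q.1 : ℝ)) * s) • EuclideanSpace.single 0 1)) - holeCentre k j,
        hne _⟩ : CStar))
      (Continuous.subtype_mk ((continuous_zC.comp (hν.comp (by fun_prop))).sub continuous_const) _) (fun a => Subtype.ext ?_) ℓ ℓ₂
      (fun t => Subtype.ext ?_) (fun t => Subtype.ext ?_)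
    · show zC _ - _ = zC _ - _
      simp only [Set.Icc.coe_zero, Set.Icc.coe_one, mul_zero, mul_one]
      rw [← zero_add (2 * Real.pi), circlePoint_add_two_pi]
    · rw [hℓ t]; simp
    · show zC _ - _ = zC _ - _
      simp [hν0]
  -- the null-homotopy of `z ∘ K₁` in `ℂ ∖ {c_j}`
  obtain ⟨H, hHc, hHne, hH0, c, hH1⟩ := hN j
  rw [h1]
  refine loopClass_eq_zero_of_free_family
    (fun q : I × I => (⟨H (q.1, circlePoint (2 * Real.pi * q.2)) - holeCentre k j, sub_ne_zero.2 (hHne _)⟩ : CStar))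
    (Continuous.subtype_mk ((hHc.comp (by fun_prop)).sub continuous_const) _) (fun a => Subtype.ext ?_) ℓ₂ (fun t => Subtype.ext ?_)
    (fun t => Subtype.ext ?_)
  · show H _ - _ = H _ - _
    simp only [Set.Icc.coe_zero, Set.Icc.coe_one, mul_zero, mul_one]
    rw [← zero_add (2 * Real.pi), circlePoint_add_two_pi]
  · show zC _ - _ = H _ - _
    rw [hH0]
  · show H _ - _ = H _ - _
    rw [hH1, hH1]

end FriendsCarrierVk

open FriendsCarrierVk in
/-- **Piece 10 of part I of V_k part A: the two push-off inputs.**  (1) For a `0`-framed oriented tubular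
neighbourhood `ν'` of a knot `J`, the push-off `t ↦ ν'(e^{2πit}, ρ e₀)` of any radius `ρ > 0` is null-homologous in
`S³ ∖ J`.  (2) For a tube `νK` of a null-homologous model knot `K₁ ⊂ M_k` and a hole `c_j`, the planar winding
loop `t ↦ z(νK(e^{2πit}, s e₀)) − c_j` is null-homologous in `ℂ ∖ 0`. [cite: Rolfsen1976, §9.F] [cite: ManolescuMarengonSarkarWillis2023, §3.1] -/
theorem helper_friendsCarrier_Vk_partA_partI_winding : (∀ (J : Knot) (ν' : Knot.TubularNbhd J) (ρ : ℝ) (b : ↥J.complement) (ℓ : Path b b), ν'.HasFraming 0 → 0 < ρ → (∀ t : unitInterval, ((ℓ t : ↥J.complement) : sphere (0 : EuclideanSpace ℝ (Fin 4)) 1) = ν' (circlePoint (2 * Real.pi * t), ρ • ((circlePoint 0 : sphere (0 : EuclideanSpace ℝ (Fin 2)) 1) : EuclideanSpace ℝ (Fin 2)))) → Literature.AlgebraicTopology.SingularHomology.loopClass ℤ ℤ (1 : ℤ) ℓ = 0) ∧ ∀ (k : ℕ) (K₁ : (sphere (0 : EuclideanSpace ℝ (Fin 2)) 1) → EuclideanSpace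 ℝ (Fin 4)) (νK : (sphere (0 : EuclideanSpace ℝ (Fin 2)) 1) × EuclideanSpace ℝ (Fin 2) → EuclideanSpace ℝ (Fin 4)), Continuous K₁ → Continuous νK → (∀ p, νK p ∈ modelBoundary k) → (∀ u : (sphere (0 : EuclideanSpace ℝ (Fin 2)) 1), νK (u, 0) = K₁ u) → IsNullHomologous k K₁ → ∀ (j : Fin k) (s : ℝ) (b : Literature.AlgebraicTopology.FundamentalGroup.PuncturedPlane.CStar) (ℓ : Path b b), (∀ t : unitInterval, ((ℓ t : Literature.AlgebraicTopology.FundamentalGroup.PuncturedPlane.CStar) : ℂ) = zC (νK (circlePoint (2 * Real.pi * t), s • EuclideanSpace.single 0 1)) - holeCentre k j) → Literature.AlgebraicTopology.SingularHomology.loopClass ℤ ℤ (1 : ℤ) ℓ = 0 :=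
  ⟨fun _ ν' _ _ ℓ hfr hρ hℓ => loopClass_radius_longitude_eq_zero ν' hfr hρ ℓ hℓ,
    fun _ K₁ νK hK hν hνM hν0 hN j s _ ℓ hℓ => loopClass_planarWinding_eq_zero K₁ νK hK hν hνM hν0 hN j s ℓ hℓ⟩

end Summit.SmoothPoincare4.SmoothPoincare4.Theorems.DcrGap.MkFriends
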